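import Literature.AlgebraicGeometry.HodgeTheory.RealSl2BlocksTimesGenericInvariance
import Literature.AlgebraicGeometry.HodgeTheory.RealSl2BlocksTimesCMDivisorClasses
import Literature.AlgebraicGeometry.Motives.HodgeStructureEndAlgCentralizerPoints
import HarnessLib

/-!
# `B = D` and the Hodge conjecture on all `A^{M+1} × C^{N+1}` for `A` with real `𝔰𝔩₂`-block data and `C` an abelian surface or threefold with `End⁰(C) = ℚ` — e.g. `E × S`, `E × T` for a non-CM elliptic curve `E` (Hazama 1989 / Moonen–Zarhin 1999 Thm. (3.2)(1), PROVED for this class)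

Family `hodge`, layer `Literature/AlgebraicGeometry/HodgeTheory`. Research context: cell `pub-hodge-ring2`
(HONEST FRAMING: research route conditional on HC_CM; not a corollary; Q11.4-sentence-2 already refuted in
dim ≥ 3), Literature lane, programme R14 («generic × generic products»), final assembly. UNCONDITIONAL;
theorems only, no definition, no named fact; nothing here uses or asserts HC_CM; no step towards a summit
statement. This file is the COMPANION of `RealSl2BlocksTimesCM{HodgeClasses, ProductSpan, DivisorClasses}`
(programme R4, «RM × CM») with the CM factor replaced by an abelian surface or threefold `C` with `End⁰(C) = ℚ`
(Moonen–Zarhin (2.2)/(2.3) Type I(1): `Hg(C) = Sp_{2g,ℚ}`, `B(Cⁿ) = D(Cⁿ)` — the tree's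
`AbelianVariety.isDivisorGenerated_powSucc_of_surface_endRankOne` / `…_of_threefold_endRankOne`), fed by the
invariance theorem `AVSlots.exists_coeff_killed_at_real_places_of_prod_endRankOne` (`RealSl2BlocksTimesGenericInvariance`).

PUBLISHED STATEMENT. Moonen–Zarhin, Math. Ann. 315 (1999), §3 Thm. (3.2)(1) (after Hazama, Duke Math. J. 58
(1989); Gordon's survey Thm. 7.6.2): «Let `X₁` and `X₂` be complex abelian varieties which both satisfy
condition (D). (1) Suppose `X₁` and `X₂` contain no factors of Type 4. Then `X₁ × X₂` again satisfies (D), and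
either `Hom(X₁, X₂) ≠ 0` or `Hg(X₁ × X₂) = Hg(X₁) × Hg(X₂)`», and the main Theorem of the introduction
(cited as Thm. 0.1): «Let `X` be a complex abelian variety with `dim(X) ≤ 4`. […] (4) Suppose we are not in one
of the cases (a), (b), (c) or (d). Then `Hg(X) = Sp_D(V,φ)` and `B•(Xⁿ) = D•(Xⁿ)` for all `n`» — the
exceptional cases (a)–(d) being fourfolds: `X₁ × X₂` with `X₁` a CM elliptic curve whose field embeds into
`End⁰(X₂)`, and three kinds of simple fourfolds [corpus: paper:arxiv-math_9901113 p. 1 (L96–L131), p. 6]. This file PROVES Thm. (3.2)(1) (as condition (D) for the product) for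
`X₁ = A` a carrier of real `𝔰𝔩₂`-block data satisfying the SIZE hypothesis (every rational space of skew
operators of `H¹(A)` commuting with `End_Hdg` has dimension `< dim C (2 dim C + 1) = dim 𝔰𝔭_{2 dim C}`; automatic for a
non-CM elliptic curve, where it is `< 4`)
and `X₂ = C` with `End⁰(C) = ℚ`, `dim C ∈ {2, 3}` — in particular for the threefolds `E × S` of Thm. 0.1 (4)
with `E` a non-CM elliptic curve and `S` an abelian surface with `End⁰(S) = ℚ` (Type I(1)), which the tree did
not cover (`RealSl2BlocksProducts`: both factors with two-dimensional blocks; `RealSl2BlocksTimesCM…`: a CM factor).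

RESULTS.
* §1 `HasRealSl2Blocks.exists_genericLetters_hodgeClasses_mem_span_map_divisor_cup_monomial` /
  `…_prod_mem_span` — the evaluated invariance theorem: Hodge classes of `X` (slots over `A × C`) are
  combinations of `f₁^* d ⌣ f₂^*(monomial in the letters of C)`, `d` a complexified divisor class (clone of
  `RealSl2BlocksTimesCMHodgeClasses` §2 with the generic invariance theorem).
* §2 `HasRealSl2Blocks.hodgeClassesProductSpan_of_avSlots_generic` — `HodgeClassesProductSpan B Z` for `B` with
  slots over `A`, `Z` with slots over `C`; `HasRealSl2Blocks.isDivisorGenerated_prod_of_avSlots_generic` —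
  `B(Z) = D(Z) ⟹ B(B × Z) = D(B × Z)`; `HasRealSl2Blocks.isStablyNondegenerate_prod_generic` — **`A × C` is
  stably nondegenerate** (all `(A × C)^{N+1}`, all `A^{M+1} × C^{N+1}` have `B = D` and satisfy the Hodge
  conjecture), the binder shape `Hazama1989_stablyNondegenerate_prod` discharged on this class.
* §3 SIZE for carriers: `HodgeStructure.finrank_le_of_forall_commute_of_isInternal_eigenBlock` (`dim_ℚ 𝔤 ≤
  Σ_t (dim T_t)²` for `𝔤` commuting with `End_Hdg`), `HasRealSl2Blocks.finrank_le_four_mul_dim` (`dim 𝔤₁ ≤ 4 dim A`).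
* §4 NO BINDER LEFT: **`HasRealSl2Blocks.isStablyNondegenerate_prod_of_endRankOne`** (`A × C` stably nondegenerate
  whenever `4 dim A < dim C (2 dim C + 1)`), mixed powers, `B = D`, the Hodge conjecture, isogeny classes; the
  real-multiplication reading `isStablyNondegenerate_prod_of_isTotallyReal_of_endRankOne` (e.g. the fourfolds
  (Type I(2) surface) × (Type I(1) surface)); ELLIPTIC CURVES **`isStablyNondegenerate_curve_prod_of_endRankOne`**
  (`E × S`, `E × T` for `End⁰(E) = ℚ`), `hodgeConjectureFor_powSucc_curve_prod_powSucc_of_endRankOne` (HC for every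
  `E^{M+1} × C^{N+1}`), `hodgeConjectureFor_of_isIsogenous_powSucc_curve_prod_of_endRankOne`.
* §5 INSTANCES: `isStablyNondegenerate_curve_prod_curve_prod_of_endRankOne` ((E₁ × E₂) × C for orthogonal non-CM
  curves, `HasRealSl2Blocks.prod`), `hodgeConjectureFor_powSucc_curve_prod_curve_prod_of_endRankOne`,
  `isStablyNondegenerate_rmSurface_prod_surface_of_endRankOne` ((Type I(2) surface) × (Type I(1) surface)),
  `isStablyNondegenerate_rm_prod_threefold_of_endRankOne` (`End⁰(A)` totally real of degree `dim A ≤ 5`, `T` of Type I(1)).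

## References
* [MoonenZarhin1999LowDim] B. Moonen, Yu. Zarhin, Math. Ann. 315 (1999) 711–733, Thm. 0.1 (4), §2 (2.2)–(2.3),
  condition (D), §3 (3.1), Thm. (3.2)(1) [corpus: paper:arxiv-math_9901113 p. 1, 4–6]. [cite: MoonenZarhin1999LowDim, §3 Thm. (3.2)(1)]
* [Hazama1989] F. Hazama, Duke Math. J. 58 (1989) 31–37 (= Gordon 7.6.2). [cite: Hazama1989, Thm. (= Gordon 7.6.2)]
* [Hazama1983] F. Hazama, Tôhoku Math. J. 35 (1983), Thm. (1.1), §3. [cite: Hazama1983, §3 (pp. 305–306)]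
* [Ribet1983] K. A. Ribet, Amer. J. Math. 105 (1983), Thm. 0–1. [cite: Ribet1983, Thm. 0–1]
* [Gordon1999HodgeAVSurvey] B. B. Gordon, App. B of Lewis (1999), Thm. 7.5, Def. 7.6, Thm. 7.6.2. [cite: Gordon1999HodgeAVSurvey, Thm. 7.5 and Thm. 7.6.2]
* [vanGeemen1994HodgeAV] B. van Geemen, LNM 1594 (1994), §2.4–2.5, Lemma 3.7, Thm. 4.2. [cite: vanGeemen1994HodgeAV, Thm. 4.2 and Lemma 3.7]
* [HatcherAT2002] A. Hatcher, *Algebraic Topology* (2002), §3.2 Thm. 3.16. [cite: HatcherAT2002, §3.2 Thm. 3.16]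
-/

noncomputable section

open scoped TensorProduct
open CategoryTheory Module

namespace Literature.AlgebraicGeometry.HodgeTheory

open Literature.AlgebraicTopology.SingularHomology
open Literature.AlgebraicGeometry.Motives (IsSmoothProjective AbelianVariety bettiCohomology
  ofRatClassBaseChange ofRatClassBaseChange_tmul HodgeTensorFacts hodgeTensorFacts_holds)
open Literature.Barriers.HodgeConjecture
open Literature.AlgebraicGeometry.Motives.HodgeStructure
open Literature.AlgebraicGeometry.ComplexMultiplication
open Literature.RepresentationTheory.GeneralLinear
open Literature.NumberTheory.DiophantineGeometry

/-! ### §1 The evaluated invariance theorem: Hodge classes over `A × C` are (divisor classes) ⌣ (monomials in the letters of `C`) -/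

section Core

variable {A B C Z X : AbelianVariety ℂ} {n : ℕ}

/-- **CORE ASSEMBLY (Hazama 1989 / Moonen–Zarhin 1999 Thm. (3.2)(1) and (3.1) for real `𝔰𝔩₂`-block data times a
generic surface or threefold, evaluated).** Let `A` carry real `𝔰𝔩₂`-block data with the SIZE hypothesis
(`dim 𝔤₁ < dim C (2 dim C + 1)` for every rational space `𝔤₁` of skew operators of `H¹(A)` commuting with
`End_Hdg`, for every polarization), `C` have `End⁰(C) = ℚ` and `dim C ∈ {2, 3}`, and let `X` have slots `g` over `A × C` whose `A`-components factor as `g_j ≫ pr_A = f₁ ≫ gB_j` through `f₁ : X → B` and whose `C`-components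
factor as `g_j ≫ pr_C = f₂ ≫ gC_j` through `f₂ : X → Z`. Then there is a Hodge-adapted pair basis
`(c_i^0 ∈ H^{1,0}, c_i^1 ∈ H^{0,1})_{i<h}` of `H¹(C) ⊗ ℂ` such that every rational class of type `(p,p)` on `X`
is a `ℂ`-combination of classes `f₁^* d ⌣ f₂^*(y_{w(1)} ⌣ ⋯ ⌣ y_{w(r)})` with `d ∈ D^{p'}(B) ⊗ ℂ`
(`divisorClassesSpan`), `2p' + r = 2p`, and `y_{((j,i),κ)} = gC_j^* ρ(c_i^κ) ∈ H¹(Z(ℂ); ℂ)`.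
[cite: MoonenZarhin1999LowDim, §3 (3.1) and Thm. (3.2)(1)] [cite: Hazama1989, Thm. (= Gordon 7.6.2)]
[cite: Hazama1983, Thm. (1.1) and §3 (pp. 305–306)] -/
theorem HasRealSl2Blocks.exists_genericLetters_hodgeClasses_mem_span_map_divisor_cup_monomial
    (hA : HasRealSl2Blocks A) (hdimA : ∀ (ψ : (BettiUniverse.hodge exists_isReal_hodgeModel_holds
        (Motives.AbelianVariety.isSmoothProjective_holds (A := A)) 1).Polarization)
      (𝔤₁ : Submodule ℚ (Module.End ℚ (bettiCohomology A.X 1))),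
      (∀ Y ∈ 𝔤₁, ∀ a : (BettiUniverse.hodge exists_isReal_hodgeModel_holds
          (Motives.AbelianVariety.isSmoothProjective_holds (A := A)) 1).endAlg,
        Y * (a : Module.End ℚ (bettiCohomology A.X 1)) = (a : Module.End ℚ (bettiCohomology A.X 1)) * Y) →
      (∀ Y ∈ 𝔤₁, ∀ v w, ψ.form (Y v) w + ψ.form v (Y w) = 0) → Module.finrank ℚ 𝔤₁ < C.dim * (2 * C.dim + 1))
    (hCend : Module.finrank ℚ C.endAlgebra = 1) (hCdim : C.dim = 2 ∨ C.dim = 3) {g : Fin n → (X ⟶ A.prod C)}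
    (hg : AVSlots (A.prod C) X g) (f₁ : X ⟶ B) (f₂ : X ⟶ Z) (gB : Fin n → (B ⟶ A)) (gC : Fin n → (Z ⟶ C))
    (hf₁ : ∀ j, g j ≫ Motives.AbelianVariety.fst A C = f₁ ≫ gB j)
    (hf₂ : ∀ j, g j ≫ Motives.AbelianVariety.snd A C = f₂ ≫ gC j) :
    ∃ (h : ℕ) (cC : Module.Basis (Fin h × Fin 2) ℂ (ℂ ⊗[ℚ] bettiCohomology C.X 1)),
      (∀ i, (cC (i, 0)) ∈ (BettiUniverse.hodge exists_isReal_hodgeModel_holds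
        (Motives.AbelianVariety.isSmoothProjective_holds (A := C)) 1).piece 1 0) ∧
      (∀ i, (cC (i, 1)) ∈ (BettiUniverse.hodge exists_isReal_hodgeModel_holds
        (Motives.AbelianVariety.isSmoothProjective_holds (A := C)) 1).piece 0 1) ∧
      ∀ (p : ℕ) (c : complexBetti X.X (2 * p)), IsRationalClass c → IsOfHodgeType X.dim X.X (2 * p) p p c →
        c ∈ Submodule.span ℂ {z : complexBetti X.X (2 * p) | ∃ (p' r : ℕ) (hpr : 2 * p' + r = 2 * p)
          (dB : complexBetti B.X (2 * p')) (w : Fin r → (Fin n × Fin h) × Fin 2),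
          dB ∈ divisorClassesSpan B.X B.dim p' ∧
          z = cupProduct hpr (complexBetti.map f₁.hom.hom.hom (2 * p') dB)
            (complexBetti.map f₂.hom.hom.hom r (cupPowOne ℂ (Motives.ComplexPoints Z.X) r (fun t =>
              complexBetti.map (gC (w t).1.1).hom.hom.hom 1
                (ofRatClassBaseChange (Motives.ComplexPoints C.X) 1 (cC ((w t).1.2, (w t).2))))))} := by
  classical
  -- unpack the real `𝔰𝔩₂`-block data of `A` (as in `HasRealSl2Blocks.isDivisorGenerated_of_avSlots`)
  obtain ⟨hc, ι, _, _, τ, hreal, hint, h2, b, hb0, hb1, hθ⟩ := hA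
  have hHD : exists_isReal_hodgeModel := exists_isReal_hodgeModel_holds
  have hI : hodgePQ_independent_of_hodgeModel := hodgePQ_independent_of_hodgeModel_holds
  haveI : HodgeTensorFacts.{0, 0} := hodgeTensorFacts_holds.{0, 0}
  haveI : Module.Finite ℚ (bettiCohomology A.X 1) := finite_bettiCohomology_one A
  have hXA : IsSmoothProjective A.dim A.X := Motives.AbelianVariety.isSmoothProjective_holds
  obtain ⟨ψ⟩ : (BettiUniverse.hodge hHD (Motives.AbelianVariety.isSmoothProjective_holds (A := A)) 1).IsPolarizable :=
    smoothProjective_hodgeStructure_isPolarizable_holds hXA (BettiUniverse.realHodgeModel hHD hXA)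
      (BettiUniverse.realHodgeModel_isHodgeSymmetric hHD hXA) 1
  set Φ := endAlgebraAlgEquivEndAlgOfComm hc hHD hI with hΦ
  have heq : ∀ i, (BettiUniverse.hodge hHD (Motives.AbelianVariety.isSmoothProjective_holds (A := A)) 1).eigenBlock
      ((τ i).comp Φ.symm.toRingEquiv.toRingHom) =
      ⨅ e : A.endAlgebra, Module.End.eigenspace ((MulOpposite.unop (bettiRep A e)).baseChange ℂ) (τ i e) :=
    fun i => eigenBlock_comp_endAlgebraAlgEquivEndAlgOfComm_symm hc hHD hI (τ i)
  have hreal' : ∀ i, (starRingEnd ℂ).comp ((τ i).comp Φ.symm.toRingEquiv.toRingHom) =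
      (τ i).comp Φ.symm.toRingEquiv.toRingHom :=
    fun i => comp_endAlgebraAlgEquivEndAlgOfComm_symm_isReal hc hHD hI (hreal i)
  have hfun : (fun i => (BettiUniverse.hodge hHD (Motives.AbelianVariety.isSmoothProjective_holds (A := A)) 1).eigenBlock
      ((τ i).comp Φ.symm.toRingEquiv.toRingHom)) = fun i => (⨅ e : A.endAlgebra,
        Module.End.eigenspace ((MulOpposite.unop (bettiRep A e)).baseChange ℂ) (τ i e) : Submodule ℂ _) :=
    funext heq
  have hint' : DirectSum.IsInternal fun i =>
      (BettiUniverse.hodge hHD (Motives.AbelianVariety.isSmoothProjective_holds (A := A)) 1).eigenBlock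
        ((τ i).comp Φ.symm.toRingEquiv.toRingHom) := by
    rw [hfun]; exact hint
  have h2' : ∀ i, Module.finrank ℂ
      ((BettiUniverse.hodge hHD (Motives.AbelianVariety.isSmoothProjective_holds (A := A)) 1).eigenBlock
        ((τ i).comp Φ.symm.toRingEquiv.toRingHom)) = 2 := fun i => by rw [heq]; exact h2 i
  have hself := isAdjointPair_self_of_real_characters
    (BettiUniverse.hodge hHD (Motives.AbelianVariety.isSmoothProjective_holds (A := A)) 1) (by norm_num)
    (BettiUniverse.hodge_isEffective hHD hXA 1) ψ _ hreal' hint'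
  let b' : ∀ i, Module.Basis (Fin 2) ℂ
      ((BettiUniverse.hodge hHD (Motives.AbelianVariety.isSmoothProjective_holds (A := A)) 1).eigenBlock
        ((τ i).comp Φ.symm.toRingEquiv.toRingHom)) :=
    fun i => (b i).map (LinearEquiv.ofEq _ _ (heq i).symm)
  have hb' : ∀ i r, (b' i r : ℂ ⊗[ℚ] bettiCohomology A.X 1) = (b i r : ℂ ⊗[ℚ] bettiCohomology A.X 1) :=
    fun i r => rfl
  have hb0' : ∀ i, (b' i 0 : ℂ ⊗[ℚ] bettiCohomology A.X 1) ∈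
      (BettiUniverse.hodge hHD (Motives.AbelianVariety.isSmoothProjective_holds (A := A)) 1).piece 1 0 :=
    fun i => by rw [hb']; exact hb0 i
  have hb1' : ∀ i, (b' i 1 : ℂ ⊗[ℚ] bettiCohomology A.X 1) ∈
      (BettiUniverse.hodge hHD (Motives.AbelianVariety.isSmoothProjective_holds (A := A)) 1).piece 0 1 :=
    fun i => by rw [hb']; exact hb1 i
  have hθ' : ∀ i, cupH1 A (b' i 0 : ℂ ⊗[ℚ] bettiCohomology A.X 1) (b' i 1) ∈
      Submodule.span ℂ {c : complexBetti A.X 2 | IsRationalClass c ∧ IsOfHodgeType A.dim A.X 2 1 1 c} :=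
    fun i => by rw [hb', hb']; exact hθ i
  -- the generic invariance theorem for slots over `A × C`
  obtain ⟨h, cC, hcC0, hcC1, hmain⟩ := hg.exists_coeff_killed_at_real_places_of_prod_endRankOne hHD hI ψ hself _
    hreal' hint' h2' b' hb0' hb1' (hdimA ψ) hCend hCdim
  refine ⟨h, cC, hcC0, hcC1, fun p c hcQ hcpp => ?_⟩
  rcases Nat.eq_zero_or_pos p with rfl | hp
  · -- degree `0`: `c = s · 1_X = f₁^*(s · 1_B) ⌣ f₂^*(1_Z)` with `s · 1_B ∈ D⁰(B) ⊗ ℂ`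
    have h1 : c ∈ Submodule.span ℂ {singularCohomology.one ℂ (Motives.ComplexPoints X.X)} :=
      AbelianVariety.mem_divisorClassesSpan_zero X c
    obtain ⟨s, hs⟩ := Submodule.mem_span_singleton.1 h1
    refine Submodule.subset_span ⟨0, 0, rfl, s • singularCohomology.one ℂ (Motives.ComplexPoints B.X),
      Fin.elim0, Submodule.smul_mem _ _ (AbelianVariety.mem_divisorClassesSpan_zero B _), ?_⟩
    rw [← hs, map_smul, LinearMap.map_smul₂, cupPowOne_zero]
    erw [singularCohomology.map_one, singularCohomology.map_one, cupProduct_one]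
  · obtain ⟨a, hca, hkill⟩ := hmain hp hcQ hcpp
    -- the letters of `X` over `A × C` are `f₁^*`(letters of `B` over `A`) and `f₂^*`(letters of `Z` over `C`)
    have hletters : (fun jr : (Fin n × (ι ⊕ Fin h)) × Fin 2 => complexBetti.map (g jr.1.1).hom.hom.hom 1
        (Sum.elim
          (fun τ' => complexBetti.map (Motives.AbelianVariety.fst A C).hom.hom.hom 1
            (ofRatClassBaseChange (Motives.ComplexPoints A.X) 1 (b' τ' jr.2 : ℂ ⊗[ℚ] bettiCohomology A.X 1)))
          (fun i => complexBetti.map (Motives.AbelianVariety.snd A C).hom.hom.hom 1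
            (ofRatClassBaseChange (Motives.ComplexPoints C.X) 1 (cC (i, jr.2))))
          jr.1.2)) =
        fun jr : (Fin n × (ι ⊕ Fin h)) × Fin 2 => Sum.elim
          (fun τ' => complexBetti.map f₁.hom.hom.hom 1 (rmLetters gB b' ((jr.1.1, τ'), jr.2)))
          (fun i => complexBetti.map f₂.hom.hom.hom 1 ((fun y : (Fin n × Fin h) × Fin 2 =>
            complexBetti.map (gC y.1.1).hom.hom.hom 1
              (ofRatClassBaseChange (Motives.ComplexPoints C.X) 1 (cC (y.1.2, y.2)))) ((jr.1.1, i), jr.2)))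
          jr.1.2 := by
      funext jr
      obtain ⟨⟨j, t⟩, κ⟩ := jr
      rcases t with τ' | i
      · simp only [Sum.elim_inl, rmLetters_apply]
        rw [complexBetti_map_map_hom, complexBetti_map_map_hom, hf₁]
      · simp only [Sum.elim_inr]
        rw [complexBetti_map_map_hom, complexBetti_map_map_hom, hf₂]
    have hmem := wordEval_mem_span_divisor_cup_monomial f₁ f₂ gB b' hθ'
      (fun y : (Fin n × Fin h) × Fin 2 => complexBetti.map (gC y.1.1).hom.hom.hom 1
        (ofRatClassBaseChange (Motives.ComplexPoints C.X) 1 (cC (y.1.2, y.2)))) (a := a)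
      (fun U τ' => hkill U τ' _ (by simp)) (fun U τ' => hkill U τ' _ (by simp))
    rw [← hletters, hca] at hmem
    exact hmem

/-- **The Hodge classes of `X` (slots over `A × C`, `A` with real `𝔰𝔩₂`-block data and SIZE, `C` a surface or
threefold with `End⁰(C) = ℚ`) are `ℂ`-combinations of `d ⌣ (x_{w(1)} ⌣ ⋯ ⌣ x_{w(r)})` with `d ∈ D^{p'}(X) ⊗ ℂ` a
complexified divisor class and the `x` the letters `g_j^* pr_C^* ρ(c_i^κ)` of `C`** — the invariants of
`Hg(A) × Hg(C)` in `H^{2p}(X)` lie in (divisor classes) ⊗ (everything on the `C`-side).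
[cite: MoonenZarhin1999LowDim, §3 (3.1) and Thm. (3.2)(1)] [cite: Hazama1989, Thm. (= Gordon 7.6.2)]
[cite: Hazama1983, Thm. (1.1) and §3 (pp. 305–306)] -/
theorem HasRealSl2Blocks.exists_genericLetters_hodgeClasses_mem_span_divisor_cup_monomial
    (hA : HasRealSl2Blocks A) (hdimA : ∀ (ψ : (BettiUniverse.hodge exists_isReal_hodgeModel_holds
        (Motives.AbelianVariety.isSmoothProjective_holds (A := A)) 1).Polarization)
      (𝔤₁ : Submodule ℚ (Module.End ℚ (bettiCohomology A.X 1))),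
      (∀ Y ∈ 𝔤₁, ∀ a : (BettiUniverse.hodge exists_isReal_hodgeModel_holds
          (Motives.AbelianVariety.isSmoothProjective_holds (A := A)) 1).endAlg,
        Y * (a : Module.End ℚ (bettiCohomology A.X 1)) = (a : Module.End ℚ (bettiCohomology A.X 1)) * Y) →
      (∀ Y ∈ 𝔤₁, ∀ v w, ψ.form (Y v) w + ψ.form v (Y w) = 0) → Module.finrank ℚ 𝔤₁ < C.dim * (2 * C.dim + 1))
    (hCend : Module.finrank ℚ C.endAlgebra = 1) (hCdim : C.dim = 2 ∨ C.dim = 3) {g : Fin n → (X ⟶ A.prod C)}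
    (hg : AVSlots (A.prod C) X g) :
    ∃ (h : ℕ) (cC : Module.Basis (Fin h × Fin 2) ℂ (ℂ ⊗[ℚ] bettiCohomology C.X 1)),
      (∀ i, (cC (i, 0)) ∈ (BettiUniverse.hodge exists_isReal_hodgeModel_holds
        (Motives.AbelianVariety.isSmoothProjective_holds (A := C)) 1).piece 1 0) ∧
      (∀ i, (cC (i, 1)) ∈ (BettiUniverse.hodge exists_isReal_hodgeModel_holds
        (Motives.AbelianVariety.isSmoothProjective_holds (A := C)) 1).piece 0 1) ∧
      ∀ (p : ℕ) (c : complexBetti X.X (2 * p)), IsRationalClass c → IsOfHodgeType X.dim X.X (2 * p) p p c →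
        c ∈ Submodule.span ℂ {z : complexBetti X.X (2 * p) | ∃ (p' r : ℕ) (hpr : 2 * p' + r = 2 * p)
          (d : complexBetti X.X (2 * p')) (w : Fin r → (Fin n × Fin h) × Fin 2),
          d ∈ divisorClassesSpan X.X X.dim p' ∧
          z = cupProduct hpr d (cupPowOne ℂ (Motives.ComplexPoints X.X) r (fun t =>
              complexBetti.map (g (w t).1.1 ≫ Motives.AbelianVariety.snd A C).hom.hom.hom 1
                (ofRatClassBaseChange (Motives.ComplexPoints C.X) 1 (cC ((w t).1.2, (w t).2)))))} := by
  obtain ⟨h, cC, hcC0, hcC1, hcore⟩ :=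
    hA.exists_genericLetters_hodgeClasses_mem_span_map_divisor_cup_monomial hdimA hCend hCdim hg (𝟙 X) (𝟙 X)
      (fun j => g j ≫ Motives.AbelianVariety.fst A C) (fun j => g j ≫ Motives.AbelianVariety.snd A C)
      (fun j => (Category.id_comp _).symm) (fun j => (Category.id_comp _).symm)
  refine ⟨h, cC, hcC0, hcC1, fun p c hcQ hc => ?_⟩
  have hid : ∀ (k : ℕ) (v : complexBetti X.X k), complexBetti.map (𝟙 X : X ⟶ X).hom.hom.hom k v = v :=
    fun k v => by
      change complexBetti.map (𝟙 X.X) k v = v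
      rw [complexBetti.map_id]
      rfl
  refine Submodule.span_mono ?_ (hcore p c hcQ hc)
  rintro z ⟨p', r, hpr, d, w, hd, rfl⟩
  refine ⟨p', r, hpr, d, w, hd, ?_⟩
  rw [hid, Motives.complexBetti_map_cupPowOne]
  simp only [hid]

/-- **The Hodge classes of `B × Z` (`B` with slots over `A` with real `𝔰𝔩₂`-block data and SIZE, `Z` with as
many slots over a surface or threefold `C` with `End⁰(C) = ℚ`) are `ℂ`-combinations of
`pr_B^* d ⌣ pr_Z^*(y_{w(1)} ⌣ ⋯ ⌣ y_{w(r)})`, `d ∈ D^{p'}(B) ⊗ ℂ`, `y` the letters `gC_j^* ρ(c_i^κ)` of `Z`** —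
«`Hg(X₁ × X₂) = Hg(X₁) × Hg(X₂)`» read on `H^{2p}(B × Z)`.
[cite: MoonenZarhin1999LowDim, §3 (3.1) and Thm. (3.2)(1)] [cite: Hazama1989, Thm. (= Gordon 7.6.2)]
[cite: Hazama1983, Thm. (1.1) and §3 (pp. 305–306)] -/
theorem HasRealSl2Blocks.exists_genericLetters_hodgeClasses_prod_mem_span (hA : HasRealSl2Blocks A)
    (hdimA : ∀ (ψ : (BettiUniverse.hodge exists_isReal_hodgeModel_holds
        (Motives.AbelianVariety.isSmoothProjective_holds (A := A)) 1).Polarization)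
      (𝔤₁ : Submodule ℚ (Module.End ℚ (bettiCohomology A.X 1))),
      (∀ Y ∈ 𝔤₁, ∀ a : (BettiUniverse.hodge exists_isReal_hodgeModel_holds
          (Motives.AbelianVariety.isSmoothProjective_holds (A := A)) 1).endAlg,
        Y * (a : Module.End ℚ (bettiCohomology A.X 1)) = (a : Module.End ℚ (bettiCohomology A.X 1)) * Y) →
      (∀ Y ∈ 𝔤₁, ∀ v w, ψ.form (Y v) w + ψ.form v (Y w) = 0) → Module.finrank ℚ 𝔤₁ < C.dim * (2 * C.dim + 1))
    (hCend : Module.finrank ℚ C.endAlgebra = 1) (hCdim : C.dim = 2 ∨ C.dim = 3)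
    {gB : Fin n → (B ⟶ A)} {gC : Fin n → (Z ⟶ C)} (hgB : AVSlots A B gB) (hgC : AVSlots C Z gC) :
    ∃ (h : ℕ) (cC : Module.Basis (Fin h × Fin 2) ℂ (ℂ ⊗[ℚ] bettiCohomology C.X 1)),
      (∀ i, (cC (i, 0)) ∈ (BettiUniverse.hodge exists_isReal_hodgeModel_holds
        (Motives.AbelianVariety.isSmoothProjective_holds (A := C)) 1).piece 1 0) ∧
      (∀ i, (cC (i, 1)) ∈ (BettiUniverse.hodge exists_isReal_hodgeModel_holds
        (Motives.AbelianVariety.isSmoothProjective_holds (A := C)) 1).piece 0 1) ∧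
      ∀ (p : ℕ) (c : complexBetti (B.prod Z).X (2 * p)), IsRationalClass c →
        IsOfHodgeType (B.prod Z).dim (B.prod Z).X (2 * p) p p c →
        c ∈ Submodule.span ℂ {z : complexBetti (B.prod Z).X (2 * p) | ∃ (p' r : ℕ) (hpr : 2 * p' + r = 2 * p)
          (dB : complexBetti B.X (2 * p')) (w : Fin r → (Fin n × Fin h) × Fin 2),
          dB ∈ divisorClassesSpan B.X B.dim p' ∧
          z = cupProduct hpr (complexBetti.map (Motives.AbelianVariety.fst B Z).hom.hom.hom (2 * p') dB)
            (complexBetti.map (Motives.AbelianVariety.snd B Z).hom.hom.hom r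
              (cupPowOne ℂ (Motives.ComplexPoints Z.X) r (fun t =>
                complexBetti.map (gC (w t).1.1).hom.hom.hom 1
                  (ofRatClassBaseChange (Motives.ComplexPoints C.X) 1 (cC ((w t).1.2, (w t).2))))))} :=
  hA.exists_genericLetters_hodgeClasses_mem_span_map_divisor_cup_monomial hdimA hCend hCdim (hgB.prodLift hgC)
    (Motives.AbelianVariety.fst B Z) (Motives.AbelianVariety.snd B Z) gB gC
    (fun _ => Motives.AbelianVariety.prodLift_fst _ _) (fun _ => Motives.AbelianVariety.prodLift_snd _ _)

end Core

/-! ### §2 The product span, `B = D` on `B × Z`, and stable nondegeneracy of `A × C` -/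

section ProductSpan

variable {A B C Z : AbelianVariety ℂ} {n : ℕ} {gB : Fin n → (B ⟶ A)} {gC : Fin n → (Z ⟶ C)}

/-- **`HodgeClassesProductSpan B Z` — Moonen–Zarhin (3.1) for (real `𝔰𝔩₂`-blocks with SIZE) × (generic surface
or threefold), PROVED.** Let `A` carry real `𝔰𝔩₂`-block data with the SIZE hypothesis, `C` have `End⁰(C) = ℚ`
and `dim C ∈ {2, 3}`, `B` have `n` slots over `A` and `Z` have `n` slots over `C`. Then every rational class of
Hodge type `(p,p)` on `B × Z` is a `ℂ`-combination of exterior products `pr_B^* a ⌣ pr_Z^* b` of RATIONAL HODGE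
classes `a` of `B` and `b` of `Z`. [cite: MoonenZarhin1999LowDim, §3 (3.1) and Thm. (3.2)(1)]
[cite: Hazama1989, Thm. (= Gordon 7.6.2)] [cite: Hazama1983, Thm. (1.1) and §3 (pp. 305–306)] -/
theorem HasRealSl2Blocks.hodgeClassesProductSpan_of_avSlots_generic (hA : HasRealSl2Blocks A)
    (hdimA : ∀ (ψ : (BettiUniverse.hodge exists_isReal_hodgeModel_holds
        (Motives.AbelianVariety.isSmoothProjective_holds (A := A)) 1).Polarization)
      (𝔤₁ : Submodule ℚ (Module.End ℚ (bettiCohomology A.X 1))),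
      (∀ Y ∈ 𝔤₁, ∀ a : (BettiUniverse.hodge exists_isReal_hodgeModel_holds
          (Motives.AbelianVariety.isSmoothProjective_holds (A := A)) 1).endAlg,
        Y * (a : Module.End ℚ (bettiCohomology A.X 1)) = (a : Module.End ℚ (bettiCohomology A.X 1)) * Y) →
      (∀ Y ∈ 𝔤₁, ∀ v w, ψ.form (Y v) w + ψ.form v (Y w) = 0) → Module.finrank ℚ 𝔤₁ < C.dim * (2 * C.dim + 1))
    (hCend : Module.finrank ℚ C.endAlgebra = 1) (hCdim : C.dim = 2 ∨ C.dim = 3)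
    (hgB : AVSlots A B gB) (hgC : AVSlots C Z gC) : HodgeClassesProductSpan B Z := by
  classical
  intro p c hcQ hc
  have hB : IsSmoothProjective B.dim B.X := Motives.AbelianVariety.isSmoothProjective_holds
  have hZ : IsSmoothProjective Z.dim Z.X := Motives.AbelianVariety.isSmoothProjective_holds
  have hXC : IsSmoothProjective C.dim C.X := Motives.AbelianVariety.isSmoothProjective_holds
  have hHD : exists_isReal_hodgeModel := exists_isReal_hodgeModel_holds
  have hI : hodgePQ_independent_of_hodgeModel := hodgePQ_independent_of_hodgeModel_holds
  obtain ⟨h, cC, hcC0, hcC1, hspan⟩ := hA.exists_genericLetters_hodgeClasses_prod_mem_span hdimA hCend hCdim hgB hgC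
  have hc' : IsOfHodgeType (B.prod Z).dim (B.prod Z).X (2 * p) p p c := by
    rw [Motives.AbelianVariety.dim_prod]; exact hc
  have hmem := hspan p c hcQ hc'
  -- the letters of `Z` have types `(1,0)` / `(0,1)`
  set y : (Fin n × Fin h) × Fin 2 → complexBetti Z.X 1 := fun jr =>
    complexBetti.map (gC jr.1.1).hom.hom.hom 1 (ofRatClassBaseChange (Motives.ComplexPoints C.X) 1 (cC (jr.1.2, jr.2)))
    with hy
  have hy0 : ∀ jr : (Fin n × Fin h) × Fin 2, jr.2 = 0 → IsOfHodgeType Z.dim Z.X 1 1 0 (y jr) := by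
    rintro ⟨⟨j, i⟩, κ⟩ hκ
    change κ = 0 at hκ
    subst hκ
    exact ((BettiUniverse.mem_hodge_piece_iff hHD hI hXC (k := 1) (p := 1) (q := 0) rfl (cC (i, 0))).1
      (hcC0 i)).map_of_isSmoothProjective hZ hXC _
  have hy1 : ∀ jr : (Fin n × Fin h) × Fin 2, jr.2 = 1 → IsOfHodgeType Z.dim Z.X 1 0 1 (y jr) := by
    rintro ⟨⟨j, i⟩, κ⟩ hκ
    change κ = 1 at hκ
    subst hκ
    exact ((BettiUniverse.mem_hodge_piece_iff hHD hI hXC (k := 1) (p := 0) (q := 1) rfl (cC (i, 1))).1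
      (hcC1 i)).map_of_isSmoothProjective hZ hXC _
  -- monomials in the letters of `Z` have a pure type
  have hmono : ∀ (r : ℕ) (w : Fin r → (Fin n × Fin h) × Fin 2), ∃ r₀ r₁, r₀ + r₁ = r ∧
      IsOfHodgeType Z.dim Z.X r r₀ r₁ (cupPowOne ℂ (Motives.ComplexPoints Z.X) r (fun t => y (w t))) := by
    intro r w
    rcases Nat.eq_zero_or_pos r with rfl | hr
    · exact ⟨0, 0, rfl, isOfHodgeType_zero_zero_of_degree_zero hZ _⟩
    · refine ⟨∑ t, (if (w t).2 = 0 then 1 else 0), ∑ t, (if (w t).2 = 0 then 0 else 1), ?_,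
        isOfHodgeType_cupPowOne hZ hr (fun t => y (w t)) _ _ fun t => ?_⟩
      · rw [← Finset.sum_add_distrib]
        have h2 : ∀ t : Fin r, ((if (w t).2 = 0 then 1 else 0) + (if (w t).2 = 0 then 0 else 1) : ℕ) = 1 :=
          fun t => by split_ifs <;> rfl
        simp only [h2, Finset.sum_const, Finset.card_univ, Fintype.card_fin, smul_eq_mul, mul_one]
      · by_cases h0 : (w t).2 = 0
        · rw [if_pos h0, if_pos h0]; exact hy0 _ h0
        · have h1 : (w t).2 = 1 := by
            have h01 : ∀ x : Fin 2, x ≠ 0 → x = 1 := by decide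
            exact h01 _ h0
          rw [if_neg h0, if_neg h0]; exact hy1 _ h1
  -- feed the criterion
  refine mem_span_hodgeProductClasses_of_mem_span_typed B Z hcQ hc (Submodule.span_mono ?_ hmem)
  rintro z ⟨p', r, hpr, dB, w, hdB, rfl⟩
  obtain ⟨r₀, r₁, hr, htyp⟩ := hmono r w
  refine ⟨2 * p', r, hpr, dB, _, Submodule.span_mono ?_ hdB, ⟨r₀, r₁, hr, htyp⟩, rfl⟩
  intro d hd
  exact ⟨isRationalClass_of_mem_divisorMonomials hd, p', rfl, isOfHodgeType_of_mem_divisorMonomials hB hd⟩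

/-- **Moonen–Zarhin Thm. (3.2)(1) as condition (D) on `B × Z`, PROVED for this class**: `B` with `n` slots over
`A` (real `𝔰𝔩₂`-block data with SIZE), `Z` with `n` slots over `C` (`End⁰(C) = ℚ`, `dim C ∈ {2, 3}`),
`B(Z) = D(Z)` ⟹ `B(B × Z) = D(B × Z)` (the product span, `B(B) = D(B)` by
`HasRealSl2Blocks.isDivisorGenerated_of_avSlots`, and `isDivisorGenerated_prod_of_productSpan`).
[cite: MoonenZarhin1999LowDim, §3 Thm. (3.2)(1)] [cite: Hazama1989, Thm. (= Gordon 7.6.2)] -/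
theorem HasRealSl2Blocks.isDivisorGenerated_prod_of_avSlots_generic (hA : HasRealSl2Blocks A)
    (hdimA : ∀ (ψ : (BettiUniverse.hodge exists_isReal_hodgeModel_holds
        (Motives.AbelianVariety.isSmoothProjective_holds (A := A)) 1).Polarization)
      (𝔤₁ : Submodule ℚ (Module.End ℚ (bettiCohomology A.X 1))),
      (∀ Y ∈ 𝔤₁, ∀ a : (BettiUniverse.hodge exists_isReal_hodgeModel_holds
          (Motives.AbelianVariety.isSmoothProjective_holds (A := A)) 1).endAlg,
        Y * (a : Module.End ℚ (bettiCohomology A.X 1)) = (a : Module.End ℚ (bettiCohomology A.X 1)) * Y) →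
      (∀ Y ∈ 𝔤₁, ∀ v w, ψ.form (Y v) w + ψ.form v (Y w) = 0) → Module.finrank ℚ 𝔤₁ < C.dim * (2 * C.dim + 1))
    (hCend : Module.finrank ℚ C.endAlgebra = 1) (hCdim : C.dim = 2 ∨ C.dim = 3)
    (hgB : AVSlots A B gB) (hgC : AVSlots C Z gC) (hZD : IsDivisorGenerated Z) : IsDivisorGenerated (B.prod Z) :=
  isDivisorGenerated_prod_of_productSpan B Z (hA.hodgeClassesProductSpan_of_avSlots_generic hdimA hCend hCdim hgB hgC)
    (hA.isDivisorGenerated_of_avSlots hgB) hZD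

/-- **`B(C^{N+1}) = D(C^{N+1})` for `End⁰(C) = ℚ`, `dim C ∈ {2, 3}`** (the tree's Type I(1) theorems
`AbelianVariety.isDivisorGenerated_powSucc_of_surface_endRankOne` / `…_of_threefold_endRankOne`, MZ99 (2.2)/(2.3)).
[cite: MoonenZarhin1999LowDim, §2 (2.2)–(2.3) and p. 715] -/
theorem isDivisorGenerated_powSucc_of_endRankOne_of_dim_two_or_three (C : AbelianVariety ℂ)
    (hCend : Module.finrank ℚ C.endAlgebra = 1) (hCdim : C.dim = 2 ∨ C.dim = 3) (N : ℕ) :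
    IsDivisorGenerated (C.powSucc N) := by
  rcases hCdim with h2 | h3
  · exact AbelianVariety.isDivisorGenerated_powSucc_of_surface_endRankOne C hCend h2 N
  · exact AbelianVariety.isDivisorGenerated_powSucc_of_threefold_endRankOne C hCend h3 N

/-- **`B(A^{N+1} × C^{N+1}) = D`** for `A` with real `𝔰𝔩₂`-block data and SIZE, `C` with `End⁰(C) = ℚ`,
`dim C ∈ {2, 3}`. [cite: MoonenZarhin1999LowDim, §3 Thm. (3.2)(1)] [cite: Gordon1999HodgeAVSurvey, Thm. 7.5 and Thm. 7.6.2] -/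
theorem HasRealSl2Blocks.isDivisorGenerated_powSucc_prod_powSucc_generic (hA : HasRealSl2Blocks A)
    (hdimA : ∀ (ψ : (BettiUniverse.hodge exists_isReal_hodgeModel_holds
        (Motives.AbelianVariety.isSmoothProjective_holds (A := A)) 1).Polarization)
      (𝔤₁ : Submodule ℚ (Module.End ℚ (bettiCohomology A.X 1))),
      (∀ Y ∈ 𝔤₁, ∀ a : (BettiUniverse.hodge exists_isReal_hodgeModel_holds
          (Motives.AbelianVariety.isSmoothProjective_holds (A := A)) 1).endAlg,
        Y * (a : Module.End ℚ (bettiCohomology A.X 1)) = (a : Module.End ℚ (bettiCohomology A.X 1)) * Y) →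
      (∀ Y ∈ 𝔤₁, ∀ v w, ψ.form (Y v) w + ψ.form v (Y w) = 0) → Module.finrank ℚ 𝔤₁ < C.dim * (2 * C.dim + 1))
    (hCend : Module.finrank ℚ C.endAlgebra = 1) (hCdim : C.dim = 2 ∨ C.dim = 3)
    (N : ℕ) : IsDivisorGenerated ((A.powSucc N).prod (C.powSucc N)) :=
  hA.isDivisorGenerated_prod_of_avSlots_generic hdimA hCend hCdim (AVSlots.powSucc A N) (AVSlots.powSucc C N)
    (isDivisorGenerated_powSucc_of_endRankOne_of_dim_two_or_three C hCend hCdim N)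

/-- **Hazama 1989 / Moonen–Zarhin Thm. (3.2)(1) as condition (D), PROVED for this class: `A × C` is stably
nondegenerate** — every power `(A × C)^{N+1}` has `B = D` (`(A × C)^{N+1} ≼ A^{N+1} × C^{N+1}`,
`isDivisorGenerated_powSucc_prod_of_isDivisorGenerated_prod_powSucc`). The binder shape of the tree's named fact
`Hazama1989_stablyNondegenerate_prod`, discharged here for (real `𝔰𝔩₂`-blocks with SIZE) × (Type I(1) surface or
threefold). [cite: MoonenZarhin1999LowDim, §3 Thm. (3.2)(1)] [cite: Hazama1989, Thm. (= Gordon 7.6.2)]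
[cite: Gordon1999HodgeAVSurvey, Thm. 7.5 (1), Def. 7.6 and Thm. 7.6.2] -/
theorem HasRealSl2Blocks.isStablyNondegenerate_prod_generic (hA : HasRealSl2Blocks A)
    (hdimA : ∀ (ψ : (BettiUniverse.hodge exists_isReal_hodgeModel_holds
        (Motives.AbelianVariety.isSmoothProjective_holds (A := A)) 1).Polarization)
      (𝔤₁ : Submodule ℚ (Module.End ℚ (bettiCohomology A.X 1))),
      (∀ Y ∈ 𝔤₁, ∀ a : (BettiUniverse.hodge exists_isReal_hodgeModel_holds
          (Motives.AbelianVariety.isSmoothProjective_holds (A := A)) 1).endAlg,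
        Y * (a : Module.End ℚ (bettiCohomology A.X 1)) = (a : Module.End ℚ (bettiCohomology A.X 1)) * Y) →
      (∀ Y ∈ 𝔤₁, ∀ v w, ψ.form (Y v) w + ψ.form v (Y w) = 0) → Module.finrank ℚ 𝔤₁ < C.dim * (2 * C.dim + 1))
    (hCend : Module.finrank ℚ C.endAlgebra = 1) (hCdim : C.dim = 2 ∨ C.dim = 3) :
    IsStablyNondegenerate (A.prod C) := fun N =>
  isDivisorGenerated_powSucc_prod_of_isDivisorGenerated_prod_powSucc A C N
    (hA.isDivisorGenerated_powSucc_prod_powSucc_generic hdimA hCend hCdim N)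

/-- **All mixed powers `A^{M+1} × C^{N+1}` are stably nondegenerate** under the same hypotheses (in particular
`B(A^{M+1} × C^{N+1}) = D` and the Hodge conjecture holds for them). [cite: MoonenZarhin1999LowDim, §3 (3.1) and Thm. (3.2)(1)]
[cite: Gordon1999HodgeAVSurvey, Def. 7.6 and Thm. 7.6.2] -/
theorem HasRealSl2Blocks.isStablyNondegenerate_powSucc_prod_powSucc_generic (hA : HasRealSl2Blocks A)
    (hdimA : ∀ (ψ : (BettiUniverse.hodge exists_isReal_hodgeModel_holds
        (Motives.AbelianVariety.isSmoothProjective_holds (A := A)) 1).Polarization)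
      (𝔤₁ : Submodule ℚ (Module.End ℚ (bettiCohomology A.X 1))),
      (∀ Y ∈ 𝔤₁, ∀ a : (BettiUniverse.hodge exists_isReal_hodgeModel_holds
          (Motives.AbelianVariety.isSmoothProjective_holds (A := A)) 1).endAlg,
        Y * (a : Module.End ℚ (bettiCohomology A.X 1)) = (a : Module.End ℚ (bettiCohomology A.X 1)) * Y) →
      (∀ Y ∈ 𝔤₁, ∀ v w, ψ.form (Y v) w + ψ.form v (Y w) = 0) → Module.finrank ℚ 𝔤₁ < C.dim * (2 * C.dim + 1))
    (hCend : Module.finrank ℚ C.endAlgebra = 1) (hCdim : C.dim = 2 ∨ C.dim = 3)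
    (M N : ℕ) : IsStablyNondegenerate ((A.powSucc M).prod (C.powSucc N)) :=
  (hA.isStablyNondegenerate_prod_generic hdimA hCend hCdim).powSucc_prod_powSucc M N

/-- **The Hodge conjecture for every `A^{M+1} × C^{N+1}`**, `A` with real `𝔰𝔩₂`-block data and SIZE, `C` with
`End⁰(C) = ℚ`, `dim C ∈ {2, 3}` — UNCONDITIONAL (`B = D` and Lefschetz `(1,1)`).
[cite: MoonenZarhin1999LowDim, §2 condition (D) and §3 Thm. (3.2)(1)] [cite: vanGeemen1994HodgeAV, §2.4] -/
theorem HasRealSl2Blocks.hodgeConjectureFor_powSucc_prod_powSucc_generic (hA : HasRealSl2Blocks A)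
    (hdimA : ∀ (ψ : (BettiUniverse.hodge exists_isReal_hodgeModel_holds
        (Motives.AbelianVariety.isSmoothProjective_holds (A := A)) 1).Polarization)
      (𝔤₁ : Submodule ℚ (Module.End ℚ (bettiCohomology A.X 1))),
      (∀ Y ∈ 𝔤₁, ∀ a : (BettiUniverse.hodge exists_isReal_hodgeModel_holds
          (Motives.AbelianVariety.isSmoothProjective_holds (A := A)) 1).endAlg,
        Y * (a : Module.End ℚ (bettiCohomology A.X 1)) = (a : Module.End ℚ (bettiCohomology A.X 1)) * Y) →
      (∀ Y ∈ 𝔤₁, ∀ v w, ψ.form (Y v) w + ψ.form v (Y w) = 0) → Module.finrank ℚ 𝔤₁ < C.dim * (2 * C.dim + 1))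
    (hCend : Module.finrank ℚ C.endAlgebra = 1) (hCdim : C.dim = 2 ∨ C.dim = 3)
    (M N : ℕ) : HodgeConjectureFor ((A.powSucc M).prod (C.powSucc N)).dim ((A.powSucc M).prod (C.powSucc N)).X :=
  (hA.isStablyNondegenerate_powSucc_prod_powSucc_generic hdimA hCend hCdim M N).hodgeConjectureFor

end ProductSpan

end Literature.AlgebraicGeometry.HodgeTheory

/-! ### §3 SIZE for carriers of real `𝔰𝔩₂`-block data: `dim 𝔤₁ ≤ dim Z(End_Hdg(H¹ A)) = 4 dim A` -/

namespace Literature.AlgebraicGeometry.Motives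

namespace HodgeStructure

variable {V : Type} [AddCommGroup V] [Module ℚ V] [Module.Finite ℚ V] {n : ℤ}

omit [Module.Finite ℚ V] in
/-- **An endomorphism commuting with `End_Hdg(V)` preserves every block `T_σ`** (`a_ℂ (Y_ℂ x) = Y_ℂ (a_ℂ x) =
σ(a) Y_ℂ x`). [cite: Hazama1983, §3 (pp. 305–306)] [cite: MoonenZarhin1999LowDim, Lemma (3.4)] -/
theorem baseChange_apply_mem_eigenBlock_of_forall_commute (H : HodgeStructure V n) (σ : H.endAlg →+* ℂ)
    {Y : Module.End ℚ V} (hY : ∀ a : H.endAlg, Y * (a : Module.End ℚ V) = (a : Module.End ℚ V) * Y)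
    {x : ℂ ⊗[ℚ] V} (hx : x ∈ H.eigenBlock σ) : Y.baseChange ℂ x ∈ H.eigenBlock σ := by
  rw [mem_eigenBlock_iff] at hx ⊢
  intro a
  rw [← LinearMap.comp_apply, ← LinearMap.baseChange_comp]
  change ((a : Module.End ℚ V) * Y).baseChange ℂ x = _
  rw [← hY a]
  change (Y ∘ₗ (a : Module.End ℚ V)).baseChange ℂ x = _
  rw [LinearMap.baseChange_comp, LinearMap.comp_apply, hx a, map_smul]

/-- **`dim_ℚ Z(End_Hdg) ≤ Σ_t (dim T_t)²`**: a rational space `𝔤` of endomorphisms of `V` commuting with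
`End_Hdg(V)` has dimension at most `Σ_t (dim_ℂ T_{σ_t})²` when the blocks `T_{σ_t}` of a family of characters
decompose `V ⊗ ℂ` — a `ℚ`-basis of `𝔤` base-changes to a `ℂ`-independent family
(`linearIndependent_end_baseChange_of_linearIndependent`) of block-preserving operators, and restriction to the
blocks embeds those into `Π_t End(T_{σ_t})`. For real `𝔰𝔩₂`-block data (`dim T_t = 2`): `dim 𝔤 ≤ 4 · #blocks
= 4 dim A` — the SIZE input `dim hg(X₁) ≤ dim Z(End_Hdg) < dim 𝔰𝔭(H¹(X₂))` of the product theorem.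
[cite: Hazama1983, §3 (pp. 305–306)] [cite: MoonenZarhin1999LowDim, §3 (3.1) and Lemma (3.4)] -/
theorem finrank_le_of_forall_commute_of_isInternal_eigenBlock (H : HodgeStructure V n) {T : Type*} [Fintype T]
    [DecidableEq T] (σ : T → (H.endAlg →+* ℂ)) (hint : DirectSum.IsInternal fun t => H.eigenBlock (σ t))
    (𝔤 : Submodule ℚ (Module.End ℚ V)) (hcomm : ∀ Y ∈ 𝔤, ∀ a : H.endAlg, Y * (a : Module.End ℚ V) = (a : Module.End ℚ V) * Y) :
    Module.finrank ℚ 𝔤 ≤ ∑ t, Module.finrank ℂ (H.eigenBlock (σ t)) * Module.finrank ℂ (H.eigenBlock (σ t)) := by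
  classical
  -- the block-preserving operators
  let Cent : Submodule ℂ (Module.End ℂ (ℂ ⊗[ℚ] V)) :=
    { carrier := {Z | ∀ t, ∀ x ∈ H.eigenBlock (σ t), Z x ∈ H.eigenBlock (σ t)}
      zero_mem' := fun t x _ => by rw [LinearMap.zero_apply]; exact Submodule.zero_mem _
      add_mem' := fun hZ hZ' t x hx => by rw [LinearMap.add_apply]; exact Submodule.add_mem _ (hZ t x hx) (hZ' t x hx)
      smul_mem' := fun c Z hZ t x hx => by rw [LinearMap.smul_apply]; exact Submodule.smul_mem _ c (hZ t x hx) }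
  have hmemCent : ∀ Z, Z ∈ Cent ↔ ∀ t, ∀ x ∈ H.eigenBlock (σ t), Z x ∈ H.eigenBlock (σ t) := fun Z => Iff.rfl
  -- (1) `dim_ℚ 𝔤 ≤ dim_ℂ Cent`: a `ℚ`-basis of `𝔤` base-changes to an independent family in `Cent`
  set b := Module.finBasis ℚ 𝔤 with hb
  have hbli : LinearIndependent ℚ fun i => ((b i : 𝔤) : Module.End ℚ V) :=
    b.linearIndependent.map' 𝔤.subtype 𝔤.ker_subtype
  have hli : LinearIndependent ℂ fun i => (((b i : 𝔤) : Module.End ℚ V)).baseChange ℂ :=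
    linearIndependent_end_baseChange_of_linearIndependent ℂ hbli
  have hmem : ∀ i, (((b i : 𝔤) : Module.End ℚ V)).baseChange ℂ ∈ Cent := fun i => by
    rw [hmemCent]
    intro t x hx
    exact H.baseChange_apply_mem_eigenBlock_of_forall_commute (σ t) (hcomm _ (b i).2) hx
  have hli' : LinearIndependent ℂ fun i => (⟨_, hmem i⟩ : Cent) :=
    LinearIndependent.of_comp Cent.subtype (by simpa [Function.comp_def] using hli)
  have h1 : Module.finrank ℚ 𝔤 ≤ Module.finrank ℂ Cent := by
    have h := hli'.fintype_card_le_finrank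
    rwa [Fintype.card_fin] at h
  -- (2) `dim Cent ≤ Σ (dim T_t)²`: restriction to the blocks is injective
  let R : Cent →ₗ[ℂ] (∀ t, Module.End ℂ (H.eigenBlock (σ t))) :=
    { toFun := fun Z t => (Z : Module.End ℂ (ℂ ⊗[ℚ] V)).restrict (Z.2 t)
      map_add' := fun Z Z' => by
        funext t; apply LinearMap.ext; intro x; apply Subtype.ext
        simp [LinearMap.restrict_apply]
      map_smul' := fun c Z => by
        funext t; apply LinearMap.ext; intro x; apply Subtype.ext
        simp [LinearMap.restrict_apply] }
  have hR : Function.Injective R := by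
    intro Z Z' hZZ'
    have hzero : ∀ t, ∀ x ∈ H.eigenBlock (σ t),
        (Z : Module.End ℂ (ℂ ⊗[ℚ] V)) x = (Z' : Module.End ℂ (ℂ ⊗[ℚ] V)) x := by
      intro t x hx
      have h := congrArg (fun f => ((f t) ⟨x, hx⟩ : ℂ ⊗[ℚ] V)) hZZ'
      simpa [R, LinearMap.restrict_apply] using h
    apply Subtype.ext
    apply LinearMap.ext
    intro x
    have hx : x ∈ ⨆ t, H.eigenBlock (σ t) := by rw [hint.submodule_iSup_eq_top]; exact Submodule.mem_top
    induction hx using Submodule.iSup_induction' with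
    | mem t x hx => exact hzero t x hx
    | zero => rw [map_zero, map_zero]
    | add x y _ _ hx hy => rw [map_add, map_add, hx, hy]
  have h2 := LinearMap.finrank_le_finrank_of_injective hR
  rw [Module.finrank_pi_fintype] at h2
  simp only [Module.finrank_linearMap] at h2
  exact h1.trans h2

end HodgeStructure

end Literature.AlgebraicGeometry.Motives

namespace Literature.AlgebraicGeometry.HodgeTheory

open Literature.AlgebraicTopology.SingularHomology
open Literature.AlgebraicGeometry.Motives (IsSmoothProjective AbelianVariety bettiCohomology
  ofRatClassBaseChange ofRatClassBaseChange_tmul HodgeTensorFacts hodgeTensorFacts_holds)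
open Literature.Barriers.HodgeConjecture
open Literature.AlgebraicGeometry.Motives.HodgeStructure
open Literature.AlgebraicGeometry.ComplexMultiplication
open Literature.RepresentationTheory.GeneralLinear
open Literature.NumberTheory.DiophantineGeometry

section Size

variable {A : AbelianVariety ℂ}

/-- **SIZE for a carrier of real `𝔰𝔩₂`-block data: `dim_ℚ 𝔤₁ ≤ 4 dim A`** for every rational space `𝔤₁` of
endomorphisms of `H¹(A; ℚ)` commuting with `End_Hdg(H¹(A))` (`= End⁰(A)` by Riemann): the `dim A` two-dimensional
blocks of `H¹(A) ⊗ ℂ` are preserved (`finrank_le_of_forall_commute_of_isInternal_eigenBlock`). In Moonen–Zarhin's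
(3.1): `dim hg(A) ≤ 3 dim A < 4 dim A`. [cite: Hazama1983, §3 (pp. 305–306)] [cite: MoonenZarhin1999LowDim, §3 (3.1)] -/
theorem HasRealSl2Blocks.finrank_le_four_mul_dim (hA : HasRealSl2Blocks A)
    (𝔤₁ : Submodule ℚ (Module.End ℚ (bettiCohomology A.X 1)))
    (hcomm : ∀ Y ∈ 𝔤₁, ∀ a : (BettiUniverse.hodge exists_isReal_hodgeModel_holds
        (Motives.AbelianVariety.isSmoothProjective_holds (A := A)) 1).endAlg,
      Y * (a : Module.End ℚ (bettiCohomology A.X 1)) = (a : Module.End ℚ (bettiCohomology A.X 1)) * Y) :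
    Module.finrank ℚ 𝔤₁ ≤ 4 * A.dim := by
  classical
  obtain ⟨hc, ι, _, _, τ, hreal, hint, h2, b, hb0, hb1, hθ⟩ := hA
  have hHD : exists_isReal_hodgeModel := exists_isReal_hodgeModel_holds
  have hI : hodgePQ_independent_of_hodgeModel := hodgePQ_independent_of_hodgeModel_holds
  haveI : Module.Finite ℚ (bettiCohomology A.X 1) := finite_bettiCohomology_one A
  set Φ := endAlgebraAlgEquivEndAlgOfComm hc hHD hI with hΦ
  have heq : ∀ i, (BettiUniverse.hodge hHD (Motives.AbelianVariety.isSmoothProjective_holds (A := A)) 1).eigenBlock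
      ((τ i).comp Φ.symm.toRingEquiv.toRingHom) =
      ⨅ e : A.endAlgebra, Module.End.eigenspace ((MulOpposite.unop (bettiRep A e)).baseChange ℂ) (τ i e) :=
    fun i => eigenBlock_comp_endAlgebraAlgEquivEndAlgOfComm_symm hc hHD hI (τ i)
  have hfun : (fun i => (BettiUniverse.hodge hHD (Motives.AbelianVariety.isSmoothProjective_holds (A := A)) 1).eigenBlock
      ((τ i).comp Φ.symm.toRingEquiv.toRingHom)) = fun i => (⨅ e : A.endAlgebra,
        Module.End.eigenspace ((MulOpposite.unop (bettiRep A e)).baseChange ℂ) (τ i e) : Submodule ℂ _) :=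
    funext heq
  have hint' : DirectSum.IsInternal fun i =>
      (BettiUniverse.hodge hHD (Motives.AbelianVariety.isSmoothProjective_holds (A := A)) 1).eigenBlock
        ((τ i).comp Φ.symm.toRingEquiv.toRingHom) := by
    rw [hfun]; exact hint
  have h2' : ∀ i, Module.finrank ℂ
      ((BettiUniverse.hodge hHD (Motives.AbelianVariety.isSmoothProjective_holds (A := A)) 1).eigenBlock
        ((τ i).comp Φ.symm.toRingEquiv.toRingHom)) = 2 := fun i => by rw [heq]; exact h2 i
  have hle := finrank_le_of_forall_commute_of_isInternal_eigenBlock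
    (BettiUniverse.hodge hHD (Motives.AbelianVariety.isSmoothProjective_holds (A := A)) 1) _ hint' 𝔤₁ hcomm
  simp only [h2', Finset.sum_const, Finset.card_univ, smul_eq_mul] at hle
  -- `#blocks = dim A`: the collected block bases form a basis of `H¹(A) ⊗ ℂ` with `2 · #ι = 2 dim A` elements
  have hcard : Fintype.card ι = A.dim := by
    have h := Module.finrank_eq_card_basis (hint.collectedBasis b)
    rw [Module.finrank_baseChange, finrank_bettiCohomology_one A, Fintype.card_sigma] at h
    simp only [Fintype.card_fin, Finset.sum_const, Finset.card_univ, smul_eq_mul] at h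
    omega
  rw [hcard] at hle
  omega

end Size

/-! ### §4 General carriers with `4 dim A < dim 𝔰𝔭_{2 dim C}`, real multiplication, elliptic curves -/

section SmallRank

variable {A C E : AbelianVariety ℂ}

/-- **Hazama 1989 / Moonen–Zarhin Thm. (3.2)(1), PROVED: `A × C` is stably nondegenerate** for `A` a carrier of
real `𝔰𝔩₂`-block data (`HasRealSl2Blocks A`: e.g. a non-CM elliptic curve, `End⁰(A)` a totally real field of degree
`dim A`, orthogonal products of such) and `C` an abelian surface or threefold with `End⁰(C) = ℚ`, whenever
`4 dim A < dim C (2 dim C + 1)` (= 10, 21): `dim A ≤ 2` against a surface, `dim A ≤ 5` against a threefold. Every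
power `(A × C)^{N+1}` and every `A^{M+1} × C^{N+1}` then has `B = D` and satisfies the Hodge conjecture. No SIZE
binder left (`HasRealSl2Blocks.finrank_le_four_mul_dim`). [cite: MoonenZarhin1999LowDim, §3 Thm. (3.2)(1) and Thm. 0.1 (4)]
[cite: Hazama1989, Thm. (= Gordon 7.6.2)] [cite: Gordon1999HodgeAVSurvey, Thm. 7.5 (1), Def. 7.6 and Thm. 7.6.2] -/
theorem HasRealSl2Blocks.isStablyNondegenerate_prod_of_endRankOne (hA : HasRealSl2Blocks A)
    (hCend : Module.finrank ℚ C.endAlgebra = 1) (hCdim : C.dim = 2 ∨ C.dim = 3)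
    (hsmall : 4 * A.dim < C.dim * (2 * C.dim + 1)) : IsStablyNondegenerate (A.prod C) :=
  hA.isStablyNondegenerate_prod_generic
    (fun _ 𝔤₁ hcomm _ => lt_of_le_of_lt (hA.finrank_le_four_mul_dim 𝔤₁ hcomm) hsmall) hCend hCdim

/-- **All `A^{M+1} × C^{N+1}` are stably nondegenerate** under the same hypotheses (so `B(A^{M+1} × C^{N+1}) = D`).
[cite: MoonenZarhin1999LowDim, §3 (3.1) and Thm. (3.2)(1)] [cite: Gordon1999HodgeAVSurvey, Def. 7.6 and Thm. 7.6.2] -/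
theorem HasRealSl2Blocks.isStablyNondegenerate_powSucc_prod_powSucc_of_endRankOne (hA : HasRealSl2Blocks A)
    (hCend : Module.finrank ℚ C.endAlgebra = 1) (hCdim : C.dim = 2 ∨ C.dim = 3)
    (hsmall : 4 * A.dim < C.dim * (2 * C.dim + 1)) (M N : ℕ) :
    IsStablyNondegenerate ((A.powSucc M).prod (C.powSucc N)) :=
  (hA.isStablyNondegenerate_prod_of_endRankOne hCend hCdim hsmall).powSucc_prod_powSucc M N

/-- **`B(A^{M+1} × C^{N+1}) = D(A^{M+1} × C^{N+1})`** under the same hypotheses.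
[cite: MoonenZarhin1999LowDim, §3 (3.1) and Thm. (3.2)(1)] -/
theorem HasRealSl2Blocks.isDivisorGenerated_powSucc_prod_powSucc_of_endRankOne (hA : HasRealSl2Blocks A)
    (hCend : Module.finrank ℚ C.endAlgebra = 1) (hCdim : C.dim = 2 ∨ C.dim = 3)
    (hsmall : 4 * A.dim < C.dim * (2 * C.dim + 1)) (M N : ℕ) :
    IsDivisorGenerated ((A.powSucc M).prod (C.powSucc N)) :=
  (hA.isStablyNondegenerate_powSucc_prod_powSucc_of_endRankOne hCend hCdim hsmall M N).isDivisorGenerated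

/-- **The Hodge conjecture for every `A^{M+1} × C^{N+1}`** under the same hypotheses — UNCONDITIONAL.
[cite: MoonenZarhin1999LowDim, §2 condition (D) and §3 Thm. (3.2)(1)] [cite: vanGeemen1994HodgeAV, §2.4] -/
theorem HasRealSl2Blocks.hodgeConjectureFor_powSucc_prod_powSucc_of_endRankOne (hA : HasRealSl2Blocks A)
    (hCend : Module.finrank ℚ C.endAlgebra = 1) (hCdim : C.dim = 2 ∨ C.dim = 3)
    (hsmall : 4 * A.dim < C.dim * (2 * C.dim + 1)) (M N : ℕ) :
    HodgeConjectureFor ((A.powSucc M).prod (C.powSucc N)).dim ((A.powSucc M).prod (C.powSucc N)).X :=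
  (hA.isStablyNondegenerate_powSucc_prod_powSucc_of_endRankOne hCend hCdim hsmall M N).hodgeConjectureFor

/-- **The Hodge conjecture for every abelian variety isogenous to some `(A × C)^{N+1}`** under the same
hypotheses (van Geemen's Lemma 3.7). [cite: vanGeemen1994HodgeAV, Lemma 3.7] [cite: MoonenZarhin1999LowDim, §3 Thm. (3.2)(1)] -/
theorem HasRealSl2Blocks.hodgeConjectureFor_of_isIsogenous_powSucc_prod_of_endRankOne (hA : HasRealSl2Blocks A)
    (hCend : Module.finrank ℚ C.endAlgebra = 1) (hCdim : C.dim = 2 ∨ C.dim = 3)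
    (hsmall : 4 * A.dim < C.dim * (2 * C.dim + 1)) {X : AbelianVariety ℂ} {N : ℕ}
    (hX : AbelianVariety.IsIsogenous X ((A.prod C).powSucc N)) : HodgeConjectureFor X.dim X.X :=
  (hA.isStablyNondegenerate_prod_of_endRankOne hCend hCdim hsmall).hodgeConjectureFor_of_isIsogenous_powSucc hX

/-- **Real multiplication of relative dimension one times a generic surface or threefold**: `End⁰(A)` a totally
real field of degree `dim A` (`hasRealSl2Blocks_of_isTotallyReal`, Ribet's class), `End⁰(C) = ℚ`, `dim C ∈ {2, 3}`,
`4 dim A < dim C (2 dim C + 1)` ⟹ `A × C` stably nondegenerate — e.g. the FOURFOLDS `A × S` with `A` a simple abelian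
surface of Type I(2) and `S` one of Type I(1) (rows of Moonen–Zarhin Thm. 0.1 (4)), and `A × T` for `dim A ≤ 5`.
[cite: MoonenZarhin1999LowDim, Thm. 0.1 (4) and §3 Thm. (3.2)(1)] [cite: Ribet1983, Thm. 0–1] -/
theorem isStablyNondegenerate_prod_of_isTotallyReal_of_endRankOne (hF : IsField A.endAlgebra)
    [NumberField.IsTotallyReal (EndField A hF)] (hdeg : Module.finrank ℚ A.endAlgebra = A.dim)
    (hCend : Module.finrank ℚ C.endAlgebra = 1) (hCdim : C.dim = 2 ∨ C.dim = 3)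
    (hsmall : 4 * A.dim < C.dim * (2 * C.dim + 1)) : IsStablyNondegenerate (A.prod C) :=
  (hasRealSl2Blocks_of_isTotallyReal A hF hdeg).isStablyNondegenerate_prod_of_endRankOne hCend hCdim hsmall

/-- **UNCONDITIONAL: `E × C` is stably nondegenerate** for an elliptic curve `E` with `End⁰(E) = ℚ` and an abelian
surface or threefold `C` with `End⁰(C) = ℚ` — Moonen–Zarhin Thm. 0.1 (4) / (3.2)(1) for the threefolds `E × S`,
`S` of Type I(1), and the fourfolds `E × T`, `T` a threefold of Type I(1): every power has `B = D`
(`hasRealSl2Blocks_of_finrank_endAlgebra_eq_one`; `4 · 1 < 10 ≤ dim 𝔰𝔭`).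
[cite: MoonenZarhin1999LowDim, Thm. 0.1 (4) and §3 Thm. (3.2)(1)] [cite: Hazama1989, Thm. (= Gordon 7.6.2)] -/
theorem isStablyNondegenerate_curve_prod_of_endRankOne (hE1 : Module.finrank ℚ E.endAlgebra = 1) (hE : E.dim = 1)
    (hCend : Module.finrank ℚ C.endAlgebra = 1) (hCdim : C.dim = 2 ∨ C.dim = 3) :
    IsStablyNondegenerate (E.prod C) :=
  (hasRealSl2Blocks_of_finrank_endAlgebra_eq_one E hE1 hE).isStablyNondegenerate_prod_of_endRankOne hCend hCdim
    (by rcases hCdim with h | h <;> rw [h, hE] <;> norm_num)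

/-- **All `E^{M+1} × C^{N+1}` are stably nondegenerate**; in particular `B(E^{M+1} × C^{N+1}) = D`.
[cite: MoonenZarhin1999LowDim, Thm. 0.1 (4) and §3 (3.1)–(3.2)] -/
theorem isStablyNondegenerate_powSucc_curve_prod_powSucc_of_endRankOne (hE1 : Module.finrank ℚ E.endAlgebra = 1)
    (hE : E.dim = 1) (hCend : Module.finrank ℚ C.endAlgebra = 1) (hCdim : C.dim = 2 ∨ C.dim = 3) (M N : ℕ) :
    IsStablyNondegenerate ((E.powSucc M).prod (C.powSucc N)) :=
  (isStablyNondegenerate_curve_prod_of_endRankOne hE1 hE hCend hCdim).powSucc_prod_powSucc M N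

/-- **`B(E^{M+1} × C^{N+1}) = D(E^{M+1} × C^{N+1})`.** [cite: MoonenZarhin1999LowDim, Thm. 0.1 (4) and §3 (3.1)–(3.2)] -/
theorem isDivisorGenerated_powSucc_curve_prod_powSucc_of_endRankOne (hE1 : Module.finrank ℚ E.endAlgebra = 1)
    (hE : E.dim = 1) (hCend : Module.finrank ℚ C.endAlgebra = 1) (hCdim : C.dim = 2 ∨ C.dim = 3) (M N : ℕ) :
    IsDivisorGenerated ((E.powSucc M).prod (C.powSucc N)) :=
  (isStablyNondegenerate_powSucc_curve_prod_powSucc_of_endRankOne hE1 hE hCend hCdim M N).isDivisorGenerated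

/-- **The Hodge conjecture for every `E^{M+1} × C^{N+1}`** (`E` an elliptic curve with `End⁰(E) = ℚ`, `C` an abelian
surface or threefold with `End⁰(C) = ℚ`) — UNCONDITIONAL. [cite: MoonenZarhin1999LowDim, Thm. 0.1 (4) and §2 condition (D)]
[cite: vanGeemen1994HodgeAV, §2.4] -/
theorem hodgeConjectureFor_powSucc_curve_prod_powSucc_of_endRankOne (hE1 : Module.finrank ℚ E.endAlgebra = 1)
    (hE : E.dim = 1) (hCend : Module.finrank ℚ C.endAlgebra = 1) (hCdim : C.dim = 2 ∨ C.dim = 3) (M N : ℕ) :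
    HodgeConjectureFor ((E.powSucc M).prod (C.powSucc N)).dim ((E.powSucc M).prod (C.powSucc N)).X :=
  (isStablyNondegenerate_powSucc_curve_prod_powSucc_of_endRankOne hE1 hE hCend hCdim M N).hodgeConjectureFor

/-- **The Hodge conjecture for `E × C` itself.** [cite: MoonenZarhin1999LowDim, Thm. 0.1 (4)] -/
theorem hodgeConjectureFor_curve_prod_of_endRankOne (hE1 : Module.finrank ℚ E.endAlgebra = 1) (hE : E.dim = 1)
    (hCend : Module.finrank ℚ C.endAlgebra = 1) (hCdim : C.dim = 2 ∨ C.dim = 3) :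
    HodgeConjectureFor (E.prod C).dim (E.prod C).X :=
  (isStablyNondegenerate_curve_prod_of_endRankOne hE1 hE hCend hCdim).hodgeConjectureFor

/-- **The Hodge conjecture for every abelian variety isogenous to a power `(E × C)^{N+1}`** (van Geemen's
Lemma 3.7). [cite: vanGeemen1994HodgeAV, Lemma 3.7] [cite: MoonenZarhin1999LowDim, Thm. 0.1 (4)] -/
theorem hodgeConjectureFor_of_isIsogenous_powSucc_curve_prod_of_endRankOne (hE1 : Module.finrank ℚ E.endAlgebra = 1)
    (hE : E.dim = 1) (hCend : Module.finrank ℚ C.endAlgebra = 1) (hCdim : C.dim = 2 ∨ C.dim = 3)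
    {X : AbelianVariety ℂ} {N : ℕ} (hX : AbelianVariety.IsIsogenous X ((E.prod C).powSucc N)) :
    HodgeConjectureFor X.dim X.X :=
  (isStablyNondegenerate_curve_prod_of_endRankOne hE1 hE hCend hCdim).hodgeConjectureFor_of_isIsogenous_powSucc hX

end SmallRank

/-! ### §5 Instances: two orthogonal non-CM elliptic curves, real-multiplication surfaces and threefolds -/

section Instances

variable {E₁ E₂ S C : AbelianVariety ℂ}

/-- **UNCONDITIONAL: `(E₁ × E₂) × C` is stably nondegenerate** for two non-isogenous («orthogonal»: `Hom = 0` both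
ways) elliptic curves with `End⁰(E_i) = ℚ` and an abelian surface or threefold `C` with `End⁰(C) = ℚ` — e.g. the
FOURFOLDS `E₁ × E₂ × S` among the rows of Moonen–Zarhin Thm. 0.1 (4) (`HasRealSl2Blocks.prod`: the product
carrier has `dim = 2`, `4 · 2 < 10`). [cite: MoonenZarhin1999LowDim, Thm. 0.1 (4) and §3 Thm. (3.2)(1)] [cite: Hazama1989, Thm. (= Gordon 7.6.2)] -/
theorem isStablyNondegenerate_curve_prod_curve_prod_of_endRankOne (h₁ : Module.finrank ℚ E₁.endAlgebra = 1)
    (hE₁ : E₁.dim = 1) (h₂ : Module.finrank ℚ E₂.endAlgebra = 1) (hE₂ : E₂.dim = 1) (h₁₂ : ∀ f : E₁ ⟶ E₂, f = 0)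
    (h₂₁ : ∀ f : E₂ ⟶ E₁, f = 0) (hCend : Module.finrank ℚ C.endAlgebra = 1) (hCdim : C.dim = 2 ∨ C.dim = 3) :
    IsStablyNondegenerate ((E₁.prod E₂).prod C) :=
  ((hasRealSl2Blocks_of_finrank_endAlgebra_eq_one E₁ h₁ hE₁).prod
    (hasRealSl2Blocks_of_finrank_endAlgebra_eq_one E₂ h₂ hE₂) h₁₂ h₂₁).isStablyNondegenerate_prod_of_endRankOne hCend hCdim
    (by rw [Motives.AbelianVariety.dim_prod, hE₁, hE₂]; rcases hCdim with h | h <;> rw [h] <;> norm_num)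

/-- **The Hodge conjecture for every power of `(E₁ × E₂) × C`** under the same hypotheses.
[cite: MoonenZarhin1999LowDim, Thm. 0.1 (4) and §2 condition (D)] [cite: vanGeemen1994HodgeAV, §2.4] -/
theorem hodgeConjectureFor_powSucc_curve_prod_curve_prod_of_endRankOne (h₁ : Module.finrank ℚ E₁.endAlgebra = 1)
    (hE₁ : E₁.dim = 1) (h₂ : Module.finrank ℚ E₂.endAlgebra = 1) (hE₂ : E₂.dim = 1) (h₁₂ : ∀ f : E₁ ⟶ E₂, f = 0)
    (h₂₁ : ∀ f : E₂ ⟶ E₁, f = 0) (hCend : Module.finrank ℚ C.endAlgebra = 1) (hCdim : C.dim = 2 ∨ C.dim = 3)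
    (N : ℕ) : HodgeConjectureFor (((E₁.prod E₂).prod C).powSucc N).dim (((E₁.prod E₂).prod C).powSucc N).X :=
  (isStablyNondegenerate_curve_prod_curve_prod_of_endRankOne h₁ hE₁ h₂ hE₂ h₁₂ h₂₁ hCend hCdim).hodgeConjectureFor_powSucc N

/-- **UNCONDITIONAL: `A × S` is stably nondegenerate for `A` an abelian SURFACE with `End⁰(A)` a real quadratic
field (Type I(2)) and `S` an abelian surface with `End⁰(S) = ℚ` (Type I(1))** — the fourfolds
(Type I(2) surface) × (Type I(1) surface) among the rows of Moonen–Zarhin's Thm. 0.1 (4) (`4 · 2 < 10 = dim 𝔰𝔭₄`).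
[cite: MoonenZarhin1999LowDim, Thm. 0.1 (4) and §3 Thm. (3.2)(1)] [cite: Ribet1983, Thm. 0–1] -/
theorem isStablyNondegenerate_rmSurface_prod_surface_of_endRankOne {A : AbelianVariety ℂ} (hF : IsField A.endAlgebra)
    [NumberField.IsTotallyReal (EndField A hF)] (hdeg : Module.finrank ℚ A.endAlgebra = A.dim) (hA : A.dim = 2)
    (hSend : Module.finrank ℚ S.endAlgebra = 1) (hS : S.dim = 2) : IsStablyNondegenerate (A.prod S) :=
  isStablyNondegenerate_prod_of_isTotallyReal_of_endRankOne hF hdeg hSend (Or.inl hS) (by rw [hA, hS]; norm_num)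

/-- **UNCONDITIONAL: `A × T` is stably nondegenerate for `End⁰(A)` a totally real field of degree `dim A ≤ 5` and
`T` an abelian THREEFOLD with `End⁰(T) = ℚ`** (`4 dim A ≤ 20 < 21 = dim 𝔰𝔭₆`).
[cite: MoonenZarhin1999LowDim, §3 Thm. (3.2)(1)] [cite: Ribet1983, Thm. 0–1] -/
theorem isStablyNondegenerate_rm_prod_threefold_of_endRankOne {A : AbelianVariety ℂ} (hF : IsField A.endAlgebra)
    [NumberField.IsTotallyReal (EndField A hF)] (hdeg : Module.finrank ℚ A.endAlgebra = A.dim) (hA : A.dim ≤ 5)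
    (hTend : Module.finrank ℚ C.endAlgebra = 1) (hT : C.dim = 3) : IsStablyNondegenerate (A.prod C) :=
  isStablyNondegenerate_prod_of_isTotallyReal_of_endRankOne hF hdeg hTend (Or.inr hT) (by rw [hT]; omega)

end Instances

end Literature.AlgebraicGeometry.HodgeTheory

end
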